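import Summits.MatrixMultiplication.OmegaCensus.SmallFormats.MatMul223RankGF3Cert
import HarnessLib

/-!
# ω-census family (a): `R_𝔽₃(⟨2,2,3⟩) = 11` unconditionally, by X-marginal caps at `r = 10`

Cell `pub-omega` (unit `pub-omega-tensor-g5`), topic `Summits/MatrixMultiplication/OmegaCensus` (sub-folder
`SmallFormats`). Framing (verbatim): lottery ticket; floor = certified bounds/negative ranges. HONEST FRAMING: the
VALUE `R(⟨2,2,3⟩) = 11` over every field is Alekseyev 1985 (tree: only via the NAMED FACT
`alekseev2015_rank_matMulTensor_m22_ge`); new for the census is an UNCONDITIONAL kernel proof over `𝔽₃` assembled from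
kernel cap theorems of three seats (ENG2's plane lemmas via `JPlane`/`QPlane`, lit's quantitative rank-one-plane cap
`card_vanishing_le_two_mul_sub` / `card_vanishing_col_quant`, this seat's flattening cap
`two_mul_add_card_perp_le_of_isUnit`, gen-4's X-rank sum) and the `decide`d certificate `cert223` of
`MatMul223RankGF3Cert.lean`. Nothing here is progress on `ω`.

THE ARGUMENT (r ≤ 10, n = 3). Every dual- or 𝔽₉-type plane cap is ≤ 1, so at most two X-forms are invertible; with
`Σ rank u_t ≥ 12` and `r ≤ 10` this forces exactly 10 nonzero X-forms: two invertible ones with distinct classes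
`i₁, i₂` sharing no capped plane, and eight rank-one ones with pairwise distinct classes, none sharing a dual-type
plane with `i₁` or `i₂`; the candidate set `C(i₁,i₂)` has 10 elements, so exactly two candidates `c₁, c₂` are
missing. lit's cap allows ≤ 2 X-forms on each rank-one plane (`2r − 6n = 2`) and the flattening cap ≤ 4 X-forms
annihilating any invertible `X₀` (`r − 2n = 4`); `cert223` says one of these fails for every `(i₁, i₂, c₁, c₂)`.
-/

namespace Summit.MatrixMultiplication.OmegaCensus.SmallFormats

open Module Matrix Literature.Computability.AlgebraicComplexity
open Summit.MatrixMultiplication.OmegaCensus.RankOnePlaneCapGeneral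

/-! ## The main count at `r ≤ 10`, `n = 3` -/

/-- `det (rep3 x) ≠ 0` on entries (`decide`). -/
theorem rep3_det_ne : ∀ x : Fin 24, rep3 x 0 0 * rep3 x 1 1 - rep3 x 0 1 * rep3 x 1 0 ≠ 0 := by decide

/-- The class representatives are invertible. -/
theorem isUnit_det_rep3 (x : Fin 24) : IsUnit (rep3 x).det := by
  rw [Matrix.det_fin_two]
  exact isUnit_iff_ne_zero.mpr (rep3_det_ne x)

/-- Swapping the two missing candidates does not change the counts. -/
theorem rowCount_swap (i₁ i₂ : Fin 24) (c₁ c₂ : Fin 16) (d : Fin 4) :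
    rowCount i₁ i₂ c₁ c₂ d = rowCount i₁ i₂ c₂ c₁ d := by
  unfold rowCount
  have h : (Finset.univ.filter fun j : Fin 16 => candB i₁ i₂ j = true ∧ j ≠ c₁ ∧ j ≠ c₂ ∧ rowVan (rep1F j) d = true)
      = (Finset.univ.filter fun j : Fin 16 => candB i₁ i₂ j = true ∧ j ≠ c₂ ∧ j ≠ c₁ ∧ rowVan (rep1F j) d = true) := by
    ext j; simp only [Finset.mem_filter]; tauto
  rw [h]
/-- Swapping the two missing candidates does not change the counts. -/
theorem colCount_swap (i₁ i₂ : Fin 24) (c₁ c₂ : Fin 16) (d : Fin 4) :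
    colCount i₁ i₂ c₁ c₂ d = colCount i₁ i₂ c₂ c₁ d := by
  unfold colCount
  have h : (Finset.univ.filter fun j : Fin 16 => candB i₁ i₂ j = true ∧ j ≠ c₁ ∧ j ≠ c₂ ∧ colVan (rep1F j) d = true)
      = (Finset.univ.filter fun j : Fin 16 => candB i₁ i₂ j = true ∧ j ≠ c₂ ∧ j ≠ c₁ ∧ colVan (rep1F j) d = true) := by
    ext j; simp only [Finset.mem_filter]; tauto
  rw [h]
/-- Swapping the two missing candidates does not change the counts. -/
theorem xCount_swap (i₁ i₂ : Fin 24) (c₁ c₂ : Fin 16) (x : Fin 24) :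
    xCount i₁ i₂ c₁ c₂ x = xCount i₁ i₂ c₂ c₁ x := by
  unfold xCount
  have h : (Finset.univ.filter fun j : Fin 16 => candB i₁ i₂ j = true ∧ j ≠ c₁ ∧ j ≠ c₂ ∧ pdot3 (rep1F j) (rep3 x) = 0)
      = (Finset.univ.filter fun j : Fin 16 => candB i₁ i₂ j = true ∧ j ≠ c₂ ∧ j ≠ c₁ ∧ pdot3 (rep1F j) (rep3 x) = 0) := by
    ext j; simp only [Finset.mem_filter]; tauto
  rw [h]

/-- The certificate for an unordered pair of missing candidates. -/
theorem cert223' {i₁ i₂ : Fin 24} (hne : i₁ ≠ i₂) (hcap : capOK3 i₁ i₂ = false) {c₁ c₂ : Fin 16} (hc : c₁ ≠ c₂)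
    (h₁ : candB i₁ i₂ c₁ = true) (h₂ : candB i₁ i₂ c₂ = true) :
    (∃ d : Fin 4, 3 ≤ rowCount i₁ i₂ c₁ c₂ d) ∨ (∃ d : Fin 4, 3 ≤ colCount i₁ i₂ c₁ c₂ d) ∨
      (∃ x : Fin 24, 5 ≤ xCount i₁ i₂ c₁ c₂ x) := by
  rcases lt_or_gt_of_ne hc with hlt | hgt
  · exact cert223 i₁ i₂ hne hcap c₁ c₂ hlt h₁ h₂
  · rcases cert223 i₁ i₂ hne hcap c₂ c₁ hgt h₂ h₁ with ⟨d, hd⟩ | ⟨d, hd⟩ | ⟨x, hx⟩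
    · exact Or.inl ⟨d, by rwa [rowCount_swap]⟩
    · exact Or.inr (Or.inl ⟨d, by rwa [colCount_swap]⟩)
    · exact Or.inr (Or.inr ⟨x, by rwa [xCount_swap]⟩)

/-- **The count**: any decomposition of `⟨2,2,3⟩` over `𝔽₃` into `r` triads has `11 ≤ r`. -/
theorem eleven_le_card_223 (r : ℕ) (w : Fin r → Fin 2 × Fin 3 → ZMod 3)
    (u : Fin r → Fin 2 × Fin 2 → ZMod 3) (v : Fin r → Fin 2 × Fin 3 → ZMod 3)
    (hdec : matMulTensor (ZMod 3) 2 2 3 = ∑ i, triad (w i) (u i) (v i)) : 11 ≤ r := by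
  classical
  by_contra hlt
  have hle : r ≤ 10 := by omega
  have hA : ∀ i x, (bilinCompOfTriads (ZMod 3) w u v hdec).f i x = dotX (u i) x := fun i x => rfl
  -- (1) plane caps ≤ 1 and pairwise exclusion
  have hJ : ∀ l : Fin 32, (Finset.univ.filter fun t => perp3 (u t) l = true).card ≤ 1 := by
    intro l
    have h := (jPlane3 l).three_mul_add_card_le (bilinCompOfTriads (ZMod 3) w u v hdec) u hA
      (fun t => perp3 (u t) l = true) (fun t ht => perp3_dotX ht)
    simp only [Fintype.card_fin] at h
    omega
  have hQ : ∀ l : Fin 18, (Finset.univ.filter fun t => perpQ3 (u t) l = true).card ≤ 1 := by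
    intro l
    have h := (qPlane3 l).three_mul_add_card_le zmod3_sq_ne (bilinCompOfTriads (ZMod 3) w u v hdec) u hA
      (fun t => perpQ3 (u t) l = true) (fun t ht => perpQ3_dotX ht)
    simp only [Fintype.card_fin] at h
    omega
  have hJ2 : ∀ l : Fin 32, ∀ t t' : Fin r, t ≠ t' → perp3 (u t) l = true → perp3 (u t') l = true → False := by
    intro l t t' htt ht ht'
    have h2 : 1 < (Finset.univ.filter fun t => perp3 (u t) l = true).card :=
      Finset.one_lt_card_iff.2 ⟨t, t', by simp [ht], by simp [ht'], htt⟩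
    have := hJ l
    omega
  have hQ2 : ∀ l : Fin 18, ∀ t t' : Fin r, t ≠ t' → perpQ3 (u t) l = true → perpQ3 (u t') l = true → False := by
    intro l t t' htt ht ht'
    have h2 : 1 < (Finset.univ.filter fun t => perpQ3 (u t) l = true).card :=
      Finset.one_lt_card_iff.2 ⟨t, t', by simp [ht], by simp [ht'], htt⟩
    have := hQ l
    omega
  -- (2) line caps (lit, quantitative rank-one planes): ≤ 2r − 6n ≤ 2
  have hRow : ∀ d : Fin 4, (Finset.univ.filter fun t => rowVan (u t) d = true).card ≤ 2 := by
    intro d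
    have h := card_vanishing_le_two_mul_sub (n := 3) (le_refl 2) (bilinCompOfTriads (ZMod 3) w u v hdec)
      (lam3_ne_zero d) (Finset.univ.filter fun t => rowVan (u t) d = true)
      (fun i hi z => by
        rw [Finset.mem_filter] at hi
        rw [hA]
        exact dotX_vecMulVec_row hi.2 z)
    simp only [Fintype.card_fin] at h
    omega
  have hCol : ∀ d : Fin 4, (Finset.univ.filter fun t => colVan (u t) d = true).card ≤ 2 := by
    intro d
    have h := card_vanishing_col_quant (c := 2) (n := 3) (le_refl 2) (bilinCompOfTriads (ZMod 3) w u v hdec)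
      (lam3_ne_zero d) (Finset.univ.filter fun t => colVan (u t) d = true)
      (fun i hi z => by
        rw [Finset.mem_filter] at hi
        rw [hA]
        exact dotX_vecMulVec_col hi.2 z)
    simp only [Fintype.card_fin] at h
    omega
  -- (3) flattening caps: ≤ r − 2n ≤ 4 terms annihilate an invertible X₀
  have hX : ∀ x : Fin 24, (Finset.univ.filter fun t => pdot3 (u t) (rep3 x) = 0).card ≤ 4 := by
    intro x
    have h := two_mul_add_card_perp_le_of_isUnit (bilinCompOfTriads (ZMod 3) w u v hdec) u hA (rep3 x)
      (isUnit_det_rep3 x) (fun t => pdot3 (u t) (rep3 x) = 0) (fun t ht => by rw [dotX_eq_pdot3]; exact ht)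
    simp only [Fintype.card_fin] at h
    omega
  -- (4) the rank sum and the bookkeeping of zero / rank-one / invertible terms
  choose ρ rr cc hρ hfac using fun i => exists_fac3 (u i)
  have hS : 2 * 2 * 3 ≤ ∑ i, ρ i :=
    RankOneXForms.kmn_le_sum_rankBound_X 2 2 3 w u v hdec ρ rr cc (fun i κ μ => hfac i κ μ)
  have hρw : ∑ i, ρ i = ∑ i, rk3 (u i) := Finset.sum_congr rfl fun i _ => hρ i
  set T2 := Finset.univ.filter (fun t : Fin r => isZero43 (u t) = false ∧ det03 (u t) = false) with hT2
  set R1 := Finset.univ.filter (fun t : Fin r => isZero43 (u t) = false ∧ det03 (u t) = true) with hR1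
  set Z0 := Finset.univ.filter (fun t : Fin r => isZero43 (u t) = true) with hZ0
  have hpt : ∀ A : Fin 2 × Fin 2 → ZMod 3, rk3 A + (if isZero43 A = true then 1 else 0)
      ≤ 1 + (if (isZero43 A = false ∧ det03 A = false) then 1 else 0) := by
    intro A
    unfold rk3
    by_cases h0 : isZero43 A = true <;> by_cases h1 : det03 A = true <;> simp [h0, h1]
  have hsum := Finset.sum_le_sum fun i (_ : i ∈ (Finset.univ : Finset (Fin r))) => hpt (u i)
  rw [Finset.sum_add_distrib, Finset.sum_add_distrib, Finset.sum_boole, Finset.sum_boole] at hsum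
  simp only [Finset.sum_const, Finset.card_univ, Fintype.card_fin, smul_eq_mul, mul_one, Nat.cast_id] at hsum
  have hpart : ∀ A : Fin 2 × Fin 2 → ZMod 3, (if isZero43 A = true then 1 else 0)
      + (if (isZero43 A = false ∧ det03 A = true) then 1 else 0)
      + (if (isZero43 A = false ∧ det03 A = false) then 1 else 0) = 1 := by
    intro A
    by_cases h0 : isZero43 A = true <;> by_cases h1 : det03 A = true <;> simp [h0, h1]
  have hpsum := Finset.sum_congr rfl fun i (_ : i ∈ (Finset.univ : Finset (Fin r))) => hpart (u i)
  rw [Finset.sum_add_distrib, Finset.sum_add_distrib, Finset.sum_boole, Finset.sum_boole, Finset.sum_boole] at hpsum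
  simp only [Finset.sum_const, Finset.card_univ, Fintype.card_fin, smul_eq_mul, mul_one, Nat.cast_id] at hpsum
  rw [← hT2] at hsum hpsum
  rw [← hZ0, ← hR1] at hpsum
  rw [← hZ0] at hsum
  -- at most two invertible terms (the triple fact), exactly as in `three_mul_add_two_le_card`
  have pair : ∀ {t t' : Fin r} {i j : Fin 24}, t ≠ t' →
      ((∀ l : Fin 32, perp3 (u t) l = perp3 (repF3 i) l) ∧ (∀ l : Fin 18, perpQ3 (u t) l = perpQ3 (repF3 i) l) ∧
        perp3 (u t) (jOfRep3 i) = true) →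
      ((∀ l : Fin 32, perp3 (u t') l = perp3 (repF3 j) l) ∧ (∀ l : Fin 18, perpQ3 (u t') l = perpQ3 (repF3 j) l) ∧
        perp3 (u t') (jOfRep3 j) = true) →
      i ≠ j ∧ capOK3 i j = false := by
    intro t t' i j htt hi hj
    constructor
    · rintro rfl
      exact hJ2 (jOfRep3 i) t t' htt hi.2.2 hj.2.2
    · rcases hc : capOK3 i j with _ | _
      · rfl
      · exfalso
        rcases exists_common_of_capOK3 hc with ⟨l, hl1, hl2⟩ | ⟨l, hl1, hl2⟩
        · exact hJ2 l t t' htt ((hi.1 l).trans hl1) ((hj.1 l).trans hl2)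
        · exact hQ2 l t t' htt ((hi.2.1 l).trans hl1) ((hj.2.1 l).trans hl2)
  have hT2le : T2.card ≤ 2 := by
    by_contra h3
    have h3' : 2 < T2.card := by omega
    obtain ⟨t1, t2, t3, ht1, ht2, ht3, h12, h13, h23⟩ := Finset.two_lt_card_iff.1 h3'
    rw [hT2, Finset.mem_filter] at ht1 ht2 ht3
    obtain ⟨i1, hi1, -⟩ := exists_sameProfile3' (u t1) ht1.2.1 ht1.2.2
    obtain ⟨i2, hi2, -⟩ := exists_sameProfile3' (u t2) ht2.2.1 ht2.2.2
    obtain ⟨i3, hi3, -⟩ := exists_sameProfile3' (u t3) ht3.2.1 ht3.2.2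
    obtain ⟨n12, c12⟩ := pair h12 (of_decide_eq_true hi1) (of_decide_eq_true hi2)
    obtain ⟨n13, c13⟩ := pair h13 (of_decide_eq_true hi1) (of_decide_eq_true hi3)
    obtain ⟨n23, c23⟩ := pair h23 (of_decide_eq_true hi2) (of_decide_eq_true hi3)
    rcases capOK3_of_three i1 i2 i3 n12 n13 n23 with h | h | h
    · rw [c12] at h; exact Bool.false_ne_true h
    · rw [c13] at h; exact Bool.false_ne_true h
    · rw [c23] at h; exact Bool.false_ne_true h
  -- hence r = 10, no zero X-form, exactly two invertible and eight rank-one X-forms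
  have hT2eq : T2.card = 2 := by omega
  have hR1card : R1.card = 8 := by omega
  -- the two invertible terms and their classes
  obtain ⟨t₁, t₂, ht12, hT2val⟩ := Finset.card_eq_two.1 hT2eq
  have ht₁ : t₁ ∈ T2 := by rw [hT2val]; simp
  have ht₂ : t₂ ∈ T2 := by rw [hT2val]; simp
  rw [hT2, Finset.mem_filter] at ht₁ ht₂
  obtain ⟨i₁, hi₁, hv₁⟩ := exists_sameProfile3' (u t₁) ht₁.2.1 ht₁.2.2
  obtain ⟨i₂, hi₂, hv₂⟩ := exists_sameProfile3' (u t₂) ht₂.2.1 ht₂.2.2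
  have hp₁ := of_decide_eq_true hi₁
  have hp₂ := of_decide_eq_true hi₂
  have hq₁ := of_decide_eq_true hv₁
  have hq₂ := of_decide_eq_true hv₂
  obtain ⟨hne12, hcap12⟩ := pair ht12 hp₁ hp₂
  -- classes of the rank-one terms
  have hcls : ∀ t ∈ R1, ∃ j : Fin 16, sameProfile1 (u t) j = true := by
    intro t ht
    rw [hR1, Finset.mem_filter] at ht
    exact exists_sameProfile1 (u t) ht.2.1 ht.2.2
  choose! cls hclsP using hcls
  -- two rank-one terms never share a class (point cap via the plane `jOfRep1F3`)
  have hinj : Set.InjOn cls ↑R1 := by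
    intro t ht t' ht' hj
    by_contra htt
    have h1 := (of_decide_eq_true (hclsP t ht)).2.2.2.2
    have h2 := (of_decide_eq_true (hclsP t' ht')).2.2.2.2
    rw [hj] at h1
    exact hJ2 _ t t' htt h1 h2
  set S := R1.image cls with hSdef
  have hScard : S.card = 8 := by rw [hSdef, Finset.card_image_of_injOn hinj, hR1card]
  -- rank-one classes avoid the planes of the two invertible classes
  have hR1T2 : ∀ t ∈ R1, t ≠ t₁ ∧ t ≠ t₂ := by
    intro t ht
    rw [hR1, Finset.mem_filter] at ht
    constructor
    · rintro rfl; rw [ht₁.2.2] at ht; exact Bool.false_ne_true ht.2.2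
    · rintro rfl; rw [ht₂.2.2] at ht; exact Bool.false_ne_true ht.2.2
  set Cset := Finset.univ.filter (fun j : Fin 16 => candB i₁ i₂ j = true) with hCdef
  have hcand : ∀ t ∈ R1, candB i₁ i₂ (cls t) = true := by
    intro t ht
    have hpr := of_decide_eq_true (hclsP t ht)
    obtain ⟨hn1, hn2⟩ := hR1T2 t ht
    have key : ∀ {i : Fin 24} {t' : Fin r}, t ≠ t' → (∀ l : Fin 32, perp3 (u t') l = perp3 (repF3 i) l) →
        jadjB (cls t) i = false := by
      intro i t' hne hprof
      rcases hj : jadjB (cls t) i with _ | _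
      · rfl
      · exfalso
        obtain ⟨l, hl1, hl2⟩ := jadjB_sound hj
        exact hJ2 l t t' hne ((hpr.1 l).trans hl1) ((hprof l).trans hl2)
    simp only [candB, key hn1 hp₁.1, key hn2 hp₂.1, Bool.not_false, Bool.and_self]
  have hSC : S ⊆ Cset := by
    intro j hj
    rw [hSdef, Finset.mem_image] at hj
    obtain ⟨t, ht, rfl⟩ := hj
    rw [hCdef, Finset.mem_filter]
    exact ⟨Finset.mem_univ _, hcand t ht⟩
  have hCcard : Cset.card = 10 := cand_card i₁ i₂ hne12 hcap12
  -- the two missing candidates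
  have hdiff : (Cset \ S).card = 2 := by
    have := Finset.card_sdiff_add_card_eq_card hSC
    omega
  obtain ⟨c₁, c₂, hc12, hCS⟩ := Finset.card_eq_two.1 hdiff
  have hc₁ : c₁ ∈ Cset \ S := by rw [hCS]; simp
  have hc₂ : c₂ ∈ Cset \ S := by rw [hCS]; simp
  rw [Finset.mem_sdiff] at hc₁ hc₂
  have hmemS : ∀ j : Fin 16, j ∈ S ↔ (candB i₁ i₂ j = true ∧ j ≠ c₁ ∧ j ≠ c₂) := by
    intro j
    constructor
    · intro hj
      refine ⟨(Finset.mem_filter.1 (hSC hj)).2, ?_, ?_⟩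
      · rintro rfl; exact hc₁.2 hj
      · rintro rfl; exact hc₂.2 hj
    · rintro ⟨hjC, hj1, hj2⟩
      by_contra hjS
      have : j ∈ Cset \ S := Finset.mem_sdiff.2 ⟨by rw [hCdef, Finset.mem_filter]; exact ⟨Finset.mem_univ _, hjC⟩, hjS⟩
      rw [hCS, Finset.mem_insert, Finset.mem_singleton] at this
      rcases this with h | h
      · exact hj1 h
      · exact hj2 h
  -- counting a class predicate over `S` = counting the corresponding term predicate over `R1`
  have hcount : ∀ (P : Fin 16 → Prop) [DecidablePred P] (Pt : Fin r → Prop) [DecidablePred Pt],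
      (∀ t ∈ R1, (Pt t ↔ P (cls t))) →
      (Finset.univ.filter fun j : Fin 16 => candB i₁ i₂ j = true ∧ j ≠ c₁ ∧ j ≠ c₂ ∧ P j).card
        = (R1.filter Pt).card := by
    intro P _ Pt _ hPt
    have h1 : (Finset.univ.filter fun j : Fin 16 => candB i₁ i₂ j = true ∧ j ≠ c₁ ∧ j ≠ c₂ ∧ P j) = S.filter P := by
      ext j
      simp only [Finset.mem_filter, Finset.mem_univ, true_and, hmemS j]
      tauto
    rw [h1, hSdef, Finset.filter_image, Finset.card_image_of_injOn]
    · congr 1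
      ext t
      simp only [Finset.mem_filter]
      constructor
      · rintro ⟨ht, hP⟩; exact ⟨ht, (hPt t ht).2 hP⟩
      · rintro ⟨ht, hP⟩; exact ⟨ht, (hPt t ht).1 hP⟩
    · intro t ht t' ht' h
      exact hinj (Finset.mem_filter.1 ht).1 (Finset.mem_filter.1 ht').1 h
  -- the certificate, and the contradiction in each case
  have hc₁C : candB i₁ i₂ c₁ = true := (Finset.mem_filter.1 hc₁.1).2
  have hc₂C : candB i₁ i₂ c₂ = true := (Finset.mem_filter.1 hc₂.1).2
  rcases cert223' hne12 hcap12 hc12 hc₁C hc₂C with ⟨d, hd⟩ | ⟨d, hd⟩ | ⟨x, hx⟩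
  · -- a row-line with ≥ 3 rank-one classes
    have h := hcount (fun j => rowVan (rep1F j) d = true) (fun t => rowVan (u t) d = true)
      (fun t ht => by rw [(of_decide_eq_true (hclsP t ht)).2.1 d])
    unfold rowCount at hd
    rw [h] at hd
    have hsub : R1.filter (fun t => rowVan (u t) d = true) ⊆ Finset.univ.filter (fun t => rowVan (u t) d = true) :=
      fun t ht => by simp only [Finset.mem_filter] at ht ⊢; exact ⟨Finset.mem_univ _, ht.2⟩
    have := Finset.card_le_card hsub
    have := hRow d
    omega
  · -- a column-line with ≥ 3 rank-one classes
    have h := hcount (fun j => colVan (rep1F j) d = true) (fun t => colVan (u t) d = true)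
      (fun t ht => by rw [(of_decide_eq_true (hclsP t ht)).2.2.1 d])
    unfold colCount at hd
    rw [h] at hd
    have hsub : R1.filter (fun t => colVan (u t) d = true) ⊆ Finset.univ.filter (fun t => colVan (u t) d = true) :=
      fun t ht => by simp only [Finset.mem_filter] at ht ⊢; exact ⟨Finset.mem_univ _, ht.2⟩
    have := Finset.card_le_card hsub
    have := hCol d
    omega
  · -- an invertible `X₀ = rep3 x` annihilated by ≥ 5 of the X-forms
    have h := hcount (fun j => pdot3 (rep1F j) (rep3 x) = 0) (fun t => pdot3 (u t) (rep3 x) = 0)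
      (fun t ht => by
        have e := (of_decide_eq_true (hclsP t ht)).2.2.2.1 x
        constructor
        · intro hp; exact of_decide_eq_true (e ▸ decide_eq_true hp)
        · intro hp; exact of_decide_eq_true (e.symm ▸ decide_eq_true hp))
    unfold xCount at hx
    rw [h] at hx
    -- the R1-part, `t₁` and `t₂` are disjoint pieces of the term filter
    have e₁ := hq₁ x
    have e₂ := hq₂ x
    have hsub : R1.filter (fun t => pdot3 (u t) (rep3 x) = 0) ∪
        ((({t₁} : Finset (Fin r)).filter fun t => pdot3 (repF3 i₁) (rep3 x) = 0) ∪
          (({t₂} : Finset (Fin r)).filter fun t => pdot3 (repF3 i₂) (rep3 x) = 0)) ⊆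
        Finset.univ.filter (fun t : Fin r => pdot3 (u t) (rep3 x) = 0) := by
      intro t ht
      rw [Finset.mem_filter]
      refine ⟨Finset.mem_univ _, ?_⟩
      simp only [Finset.mem_union, Finset.mem_filter, Finset.mem_singleton] at ht
      rcases ht with ⟨_, hp⟩ | ⟨rfl, hp⟩ | ⟨rfl, hp⟩
      · exact hp
      · exact of_decide_eq_true (e₁.symm ▸ decide_eq_true hp)
      · exact of_decide_eq_true (e₂.symm ▸ decide_eq_true hp)
    have hdisj1 : Disjoint (R1.filter (fun t => pdot3 (u t) (rep3 x) = 0))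
        ((({t₁} : Finset (Fin r)).filter fun t => pdot3 (repF3 i₁) (rep3 x) = 0) ∪
          (({t₂} : Finset (Fin r)).filter fun t => pdot3 (repF3 i₂) (rep3 x) = 0)) := by
      rw [Finset.disjoint_left]
      intro t ht ht'
      simp only [Finset.mem_union, Finset.mem_filter, Finset.mem_singleton] at ht ht'
      obtain ⟨hn1, hn2⟩ := hR1T2 t ht.1
      rcases ht' with ⟨h, _⟩ | ⟨h, _⟩
      · exact hn1 h
      · exact hn2 h
    have hdisj2 : Disjoint ((({t₁} : Finset (Fin r)).filter fun t => pdot3 (repF3 i₁) (rep3 x) = 0))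
        ((({t₂} : Finset (Fin r)).filter fun t => pdot3 (repF3 i₂) (rep3 x) = 0)) := by
      rw [Finset.disjoint_left]
      intro t ht ht'
      simp only [Finset.mem_filter, Finset.mem_singleton] at ht ht'
      exact ht12 (ht.1.symm.trans ht'.1)
    have hcardU := Finset.card_le_card hsub
    rw [Finset.card_union_of_disjoint hdisj1, Finset.card_union_of_disjoint hdisj2] at hcardU
    have hs1 : ((({t₁} : Finset (Fin r)).filter fun t => pdot3 (repF3 i₁) (rep3 x) = 0)).card
        = (if pdot3 (repF3 i₁) (rep3 x) = 0 then 1 else 0) := by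
      rw [Finset.filter_singleton]; split_ifs <;> simp
    have hs2 : ((({t₂} : Finset (Fin r)).filter fun t => pdot3 (repF3 i₂) (rep3 x) = 0)).card
        = (if pdot3 (repF3 i₂) (rep3 x) = 0 then 1 else 0) := by
      rw [Finset.filter_singleton]; split_ifs <;> simp
    rw [hs1, hs2] at hcardU
    have := hX x
    omega

/-- **`11 ≤ R_𝔽₃(⟨2,2,3⟩)`** unconditionally. -/
theorem eleven_le_tensorRank_matMulTensor_223_gf3 : 11 ≤ tensorRank (matMulTensor (ZMod 3) 2 2 3) := by
  obtain ⟨w, u, v, hdec⟩ := exists_triad_decomposition_tensorRank (matMulTensor (ZMod 3) 2 2 3)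
  exact eleven_le_card_223 _ w u v hdec

/-- **`R_𝔽₃(⟨2,2,3⟩) = 11`** unconditionally (Alekseyev 1985's value over `𝔽₃`; ceiling = Hopcroft–Kerr gluing). -/
theorem tensorRank_matMulTensor_223_gf3 : tensorRank (matMulTensor (ZMod 3) 2 2 3) = 11 :=
  le_antisymm (hopcroftKerr1971_tensorRank_matMulTensor_22n_le (K := ZMod 3) 3) eleven_le_tensorRank_matMulTensor_223_gf3

/-- The orientations: `R_𝔽₃(⟨2,3,2⟩) = R_𝔽₃(⟨3,2,2⟩) = 11`. -/
theorem tensorRank_matMulTensor_232_322_gf3 :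
    tensorRank (matMulTensor (ZMod 3) 2 3 2) = 11 ∧ tensorRank (matMulTensor (ZMod 3) 3 2 2) = 11 := by
  constructor
  · rw [(Blaser2013_lemma55 (ZMod 3) 2 3 2).1]; exact tensorRank_matMulTensor_223_gf3
  · rw [(Blaser2013_lemma55 (ZMod 3) 3 2 2).2.1]; exact tensorRank_matMulTensor_223_gf3

end Summit.MatrixMultiplication.OmegaCensus.SmallFormats
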